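import Summits.PneNP.PneNP.Theorems.SymmetryBudgetWindowCanoniserSoundB3

/-!
# Window canoniser, XXVII': soundness at section nodes, IV — the section value bits; soundness of every label

Route `PneNP/SymmetryBudget`, dichotomy `WindowBarrier` (stmt-PneNP-2145) / `NoHiddenOrder` (stmt-PneNP-14781);
continuation of `…WindowCanoniserSoundB3.lean`.  The section value bits are the data of the pasted ordering
(`WCan.SecCtx.svP_iff`, using the decoded addresses of the previous file); hence soundness at section nodes
(`WCan.sound_sec`) and, by induction on the measure of labels, **soundness of every label** (`WCan.sound`).
-/

-- `Summit.PneNP.PneNP.…` duplicates `PneNP` BY DESIGN (single-problem summit, D-0017 layout).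
set_option linter.dupNamespace false

noncomputable section

namespace Summit.PneNP.PneNP.Theorems

namespace WCan

open Finset Literature.Computability.Complexity Literature.Computability.Complexity.CGCanon
  Literature.Combinatorics.SimpleGraph
open scoped Classical

variable {K r n : ℕ} [NeZero n]

namespace SecCtx

variable {L : Lab K n} {x : Fin (r + n) × Fin (r + n) → Bool} {ordK : Finset (Fin n) → ℕ → Fin n} (C : SecCtx L x ordK)
  (hn : 2 ≤ n)
include C hn


/-! ### The section value bits are the data of the pasted ordering -/

omit [NeZero n] C hn in
/-- `swP` is class-level. -/
theorem swP_congr {a a' b b' : Fin n} (ha : EQP (r := r) L x a a') (hb : EQP (r := r) L x b b') :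
    swP x (finSt L.1 x) a b ↔ swP x (finSt L.1 x) a' b' := by
  rw [EQP_iff] at ha hb
  have hca : lcell (finSt L.1 x) a = lcell (finSt L.1 x) a' := by unfold lcell; simp only [ha]
  have hcb : lcell (finSt L.1 x) b = lcell (finSt L.1 x) b' := by unfold lcell; simp only [hb]
  unfold swP; rw [hca, hcb]

omit hn in
/-- Across parts, adjacency is the switch bit. -/
theorem adj_iff_swP {p q : ℕ} (hp : p < L.1.U.card) (hq : q < L.1.U.card) (hne : Kp (L := L) (x := x) (ordK := ordK) p ≠ Kp (L := L) (x := x) (ordK := ordK) q) :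
    (G x).Adj (ORD (L := L) (x := x) (ordK := ordK) p) (ORD (L := L) (x := x) (ordK := ordK) q) ↔ swP x (finSt L.1 x) (ORD (L := L) (x := x) (ordK := ordK) p) (ORD (L := L) (x := x) (ordK := ordK) q) := by
  have hpW : ORD (L := L) (x := x) (ordK := ordK) p ∈ (finSt L.1 x).W := by rw [C.hW]; exact C.validOrd_ORD.1 p hp
  have hqW : ORD (L := L) (x := x) (ordK := ordK) q ∈ (finSt L.1 x).W := by rw [C.hW]; exact C.validOrd_ORD.1 q hq
  have hvne : ORD (L := L) (x := x) (ordK := ordK) p ≠ ORD (L := L) (x := x) (ordK := ordK) q := fun h => hne (by rw [← C.Kf_ORD hp, ← C.Kf_ORD hq, h])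
  have hnadj : ¬ (swG (G x) (finSt L.1 x).W (finSt L.1 x).c).Adj (ORD (L := L) (x := x) (ordK := ordK) p) (ORD (L := L) (x := x) (ordK := ordK) q) := by
    intro hadj
    have : ORD (L := L) (x := x) (ordK := ordK) q ∈ Kf L x (ORD (L := L) (x := x) (ordK := ordK) p) := mem_comp.2 ⟨hqW, hadj.reachable⟩
    exact hne (by rw [← C.Kf_ORD hp, ← C.Kf_ORD hq, Kf_eq_of_mem this])
  rw [swP_iff_switch x hpW hqW]
  exact adj_iff_switch_of_not_adj hpW hqW hvne hnadj

omit hn in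
/-- **`pbit` on adjacency bits.** -/
theorem pbitP_adj_iff {u : Fin n} (hu : u ∈ L.1.U) (o o' : Fin n) : pbitP (r := r) L x u (bpVal (benc (.adj o o'))) ↔
    ((o : ℕ) < (Kf L x u).card ∧ (o' : ℕ) < (Kf L x u).card ∧ (G x).Adj (ordK (Kf L x u) o) (ordK (Kf L x u) o')) := by
  obtain ⟨Lc, hLc, -, -, -, -⟩ := C.part u hu
  obtain ⟨hLc1, -, -⟩ := partLab_spec hLc
  have hUc : Lc.1.U = Kf L x u := by rw [hLc1]; rfl
  rw [C.pbitP_iff hu]; simp [hLc, Data, hUc]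

omit hn in
/-- **`pbit` on outside bits.** -/
theorem pbitP_ext_iff {u : Fin n} (hu : u ∈ L.1.U) (o : Fin n) (oo : Fin r) : pbitP (r := r) L x u (bpVal (benc (.ext o oo))) ↔
    ((o : ℕ) < (Kf L x u).card ∧ xo x (ordK (Kf L x u) o) oo = true) := by
  obtain ⟨Lc, hLc, -, -, -, -⟩ := C.part u hu
  obtain ⟨hLc1, -, -⟩ := partLab_spec hLc
  have hUc : Lc.1.U = Kf L x u := by rw [hLc1]; rfl
  rw [C.pbitP_iff hu]; simp [hLc, Data, hUc]

/-- **The section value bits are the data of the pasted ordering.** -/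
theorem svP_iff (b : BIdx r n) : svP (r := r) L x b ↔ Data L.1 x (ORD (L := L) (x := x) (ordK := ordK)) b := by
  rcases b with ⟨p, q⟩ | ⟨p, oo⟩ | ⟨p, j⟩
  · -- adjacency
    simp only [svP, Data, C.samePartP_iff hn, C.spcP_iff hn]
    constructor
    · rintro (⟨⟨hp, hq, he⟩, u, o, o', hop, hoq, hb⟩ | ⟨hns, w, w', ⟨hp, hw⟩, ⟨hq, hw'⟩, hsw⟩)
      · have hu := mem_U_of_offP hop
        rw [C.offP_iff hn hu] at hop hoq
        rw [C.pbitP_adj_iff hu] at hb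
        obtain ⟨-, hvec, hpo⟩ := hop
        obtain ⟨-, hvec', hqo⟩ := hoq
        obtain ⟨ho, ho', hadj⟩ := hb
        refine ⟨hp, hq, ?_⟩
        rw [adj_transfer hvec.symm ho ho'] at hadj
        rw [← he] at hqo
        rw [ORD, ORD, ← he]
        convert hadj using 2 <;> omega
      · refine ⟨hp, hq, ?_⟩
        have hne : Kp (L := L) (x := x) (ordK := ordK) p ≠ Kp (L := L) (x := x) (ordK := ordK) q := fun h => hns ⟨hp, hq, h⟩
        rw [C.adj_iff_swP hp hq hne, swP_congr hw hw']; exact hsw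
    · rintro ⟨hp, hq, hadj⟩
      by_cases he : Kp (L := L) (x := x) (ordK := ordK) p = Kp (L := L) (x := x) (ordK := ordK) q
      · left
        have hu : ORD (L := L) (x := x) (ordK := ordK) p ∈ L.1.U := C.validOrd_ORD.1 p hp
        have hKf : Kf L x (ORD (L := L) (x := x) (ordK := ordK) p) = Kp (L := L) (x := x) (ordK := ordK) p := C.Kf_ORD hp
        obtain ⟨hKp, hc1, hc2⟩ := C.Kp_spec hp
        obtain ⟨hKq, hq1, hq2⟩ := C.Kp_spec hq
        have hon : (p : ℕ) - cstart (L := L) (x := x) (ordK := ordK) (Kp (L := L) (x := x) (ordK := ordK) p) < n := by have := card_le_n (Kp (L := L) (x := x) (ordK := ordK) p); omega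
        have hon' : (q : ℕ) - cstart (L := L) (x := x) (ordK := ordK) (Kp (L := L) (x := x) (ordK := ordK) q) < n := by have := card_le_n (Kp (L := L) (x := x) (ordK := ordK) q); omega
        refine ⟨⟨hp, hq, he⟩, ORD (L := L) (x := x) (ordK := ordK) p, ⟨_, hon⟩, ⟨_, hon'⟩, ?_, ?_, ?_⟩
        · rw [C.offP_iff hn hu, hKf]; exact ⟨hp, rfl, show (p : ℕ) = cstart (L := L) (x := x) (ordK := ordK) (Kp (L := L) (x := x) (ordK := ordK) p) + ((p : ℕ) - cstart (L := L) (x := x) (ordK := ordK) (Kp (L := L) (x := x) (ordK := ordK) p)) by omega⟩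
        · rw [C.offP_iff hn hu, hKf, he]; exact ⟨hq, rfl, show (q : ℕ) = cstart (L := L) (x := x) (ordK := ordK) (Kp (L := L) (x := x) (ordK := ordK) q) + ((q : ℕ) - cstart (L := L) (x := x) (ordK := ordK) (Kp (L := L) (x := x) (ordK := ordK) q)) by omega⟩
        · rw [C.pbitP_adj_iff hu, hKf]
          refine ⟨show (p : ℕ) - cstart (L := L) (x := x) (ordK := ordK) (Kp (L := L) (x := x) (ordK := ordK) p) < (Kp (L := L) (x := x) (ordK := ordK) p).card by omega,
            show (q : ℕ) - cstart (L := L) (x := x) (ordK := ordK) (Kp (L := L) (x := x) (ordK := ordK) q) < (Kp (L := L) (x := x) (ordK := ordK) p).card by rw [he]; omega, ?_⟩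
          rw [ORD, ORD] at hadj
          convert hadj using 2
      · right
        exact ⟨fun h => he h.2.2, ORD (L := L) (x := x) (ordK := ordK) p, ORD (L := L) (x := x) (ordK := ordK) q, ⟨hp, liftLT_irrefl _ _, liftLT_irrefl _ _⟩, ⟨hq, liftLT_irrefl _ _, liftLT_irrefl _ _⟩,
          (C.adj_iff_swP hp hq he).1 hadj⟩
  · -- outside bits
    simp only [svP, Data]
    constructor
    · rintro ⟨u, o, hoff, hb⟩
      have hu := mem_U_of_offP hoff
      rw [C.offP_iff hn hu] at hoff
      rw [C.pbitP_ext_iff hu] at hb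
      obtain ⟨hp, hvec, hpo⟩ := hoff
      obtain ⟨ho, hxo⟩ := hb
      refine ⟨hp, ?_⟩
      rw [ext_transfer hvec.symm ho] at hxo
      rw [ORD, ← hxo]; congr 2; omega
    · rintro ⟨hp, hxo⟩
      have hu : ORD (L := L) (x := x) (ordK := ordK) p ∈ L.1.U := C.validOrd_ORD.1 p hp
      have hKf : Kf L x (ORD (L := L) (x := x) (ordK := ordK) p) = Kp (L := L) (x := x) (ordK := ordK) p := C.Kf_ORD hp
      obtain ⟨hKp, hc1, hc2⟩ := C.Kp_spec hp
      have hon : (p : ℕ) - cstart (L := L) (x := x) (ordK := ordK) (Kp (L := L) (x := x) (ordK := ordK) p) < n := by have := card_le_n (Kp (L := L) (x := x) (ordK := ordK) p); omega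
      refine ⟨ORD (L := L) (x := x) (ordK := ordK) p, ⟨_, hon⟩, ?_, ?_⟩
      · rw [C.offP_iff hn hu, hKf]; exact ⟨hp, rfl, show (p : ℕ) = cstart (L := L) (x := x) (ordK := ordK) (Kp (L := L) (x := x) (ordK := ordK) p) + ((p : ℕ) - cstart (L := L) (x := x) (ordK := ordK) (Kp (L := L) (x := x) (ordK := ordK) p)) by omega⟩
      · rw [C.pbitP_ext_iff hu, hKf]; exact ⟨show (p : ℕ) - cstart (L := L) (x := x) (ordK := ordK) (Kp (L := L) (x := x) (ordK := ordK) p) < (Kp (L := L) (x := x) (ordK := ordK) p).card by omega, hxo⟩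
  · -- colour ranks
    simp only [svP, Data, C.spcP_iff hn]
    constructor
    · rintro ⟨w, ⟨hp, heq⟩, hj⟩
      refine ⟨hp, ?_⟩
      rw [← hj, rankF_eq, rankF_eq]
      exact rankS_eq_of_not_lt _ heq.1 heq.2
    · rintro ⟨hp, hj⟩
      exact ⟨ORD (L := L) (x := x) (ordK := ordK) p, ⟨hp, liftLT_irrefl _ _, liftLT_irrefl _ _⟩, hj⟩

/-- **The value bits of a section node are the data of the pasted ordering.** -/
theorem bits_iff (z' : Fin n) (b : Fin (NB r n)) : ev x (aVbit (r := r) L z' b) = true ↔ Data L.1 x (ORD (L := L) (x := x) (ordK := ordK)) (bdec b) := by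
  rw [ev_aVbit_main hn C.hU]
  simp only [C.hnc, false_and, not_false_eq_true, true_and, false_or, C.svP_iff hn]
  rcases bdec b with ⟨p, q⟩ | ⟨p, o⟩ | ⟨p, j⟩ <;> simp only [inRng, Data] <;> tauto

end SecCtx

/-! ### Soundness -/

variable {x : Fin (r + n) × Fin (r + n) → Bool} (hn : 2 ≤ n)
include hn

omit [NeZero n] hn in
/-- The part named by `isP` is the part. -/
theorem Kf_of_isPartP {L : Lab K n} (hok : okP L.1 x) {u : Fin n} {U' : Finset (Fin n)} (h : isPartP (r := r) L x u U') :
    U' = Kf L x u := by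
  obtain ⟨hu, -, -, hv⟩ := h
  have hW := (finSt_eq_of_okP L.1 x hok).1
  ext v
  rw [hv v, mem_comp, hW]
  exact ⟨fun ⟨_, h2⟩ => ⟨mem_of_reachable hu h2, h2⟩, fun ⟨_, h2⟩ => ⟨hu, h2⟩⟩

/-- **Soundness at a section node** (final state disconnected), given soundness of the smaller labels. -/
theorem sound_sec (L : Lab K n) (hU : ¬ L.1.U.card ≤ 1) (hnc : ¬ IsConn (G x) (finSt L.1 x).W (finSt L.1 x).c)
    (IH : ∀ Lc : Lab K n, Lc.1.M < L.1.M → SoundAt (r := r) Lc x) : SoundAt (r := r) L x := by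
  intro hok z hNB
  rw [NBP_iff hn] at hNB
  rcases hNB with h | ⟨h, -⟩ | ⟨-, hall⟩
  · exact absurd h hU
  · exact absurd h hnc
  -- the orderings of the parts, by choice from the induction hypothesis
  let Good : Finset (Fin n) → (ℕ → Fin n) → Prop := fun K' ord =>
    ∃ Lc, partLab L K' = some Lc ∧ ValidOrd K' ord ∧ ∀ z' b, ev x (aVbit (r := r) Lc z' b) = true ↔ Data Lc.1 x ord (bdec b)
  let ordK : Finset (Fin n) → ℕ → Fin n := fun K' => if h : ∃ ord, Good K' ord then Classical.choose h else fun _ => ⟨0, NeZero.pos n⟩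
  have hctx : SecCtx L x ordK := by
    refine ⟨hU, hok, hnc, fun u hu => ?_⟩
    have hcov := hall u hu
    rw [ev_aPcov hn, decide_eq_true_iff] at hcov
    obtain ⟨U', hP, hcert⟩ := hcov
    have hU' := Kf_of_isPartP hok hP
    subst hU'
    rw [certS, ev_aCert_inr hn, decide_eq_true_iff] at hcert
    obtain ⟨Lc, hLc, hthru, hokc, hNBc⟩ := hcert
    obtain ⟨hLc1, -, -⟩ := partLab_spec hLc
    have hUc : Lc.1.U = Kf L x u := by rw [hLc1]; rfl
    obtain ⟨ord, hvalid, hdata⟩ := IH Lc (M_partLab_lt L hLc) hokc u hNBc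
    have hgood : ∃ ord, Good (Kf L x u) ord := ⟨ord, Lc, hLc, hUc ▸ hvalid, hdata⟩
    have hsel : ordK (Kf L x u) = Classical.choose hgood := by simp only [ordK, dif_pos hgood]
    obtain ⟨Lc', hLc', hvalid', hdata'⟩ := Classical.choose_spec hgood
    rw [hLc] at hLc'; cases hLc'
    exact ⟨Lc, hLc, hthru, hokc, hsel ▸ hvalid', fun z' b => hsel ▸ hdata' z' b⟩
  exact ⟨_, hctx.validOrd_ORD, hctx.bits_iff hn⟩

/-- **Soundness of every label.** -/
theorem sound (L : Lab K n) : SoundAt (r := r) L x := by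
  induction hM : L.1.M using Nat.strong_induction_on generalizing L with
  | _ M ih =>
    have IH : ∀ Lc : Lab K n, Lc.1.M < L.1.M → SoundAt (r := r) Lc x := fun Lc hlt => ih Lc.1.M (hM ▸ hlt) Lc rfl
    by_cases hU : L.1.U.card ≤ 1
    · exact sound_leaf L hU
    · by_cases hconn : IsConn (G x) (finSt L.1 x).W (finSt L.1 x).c
      · exact sound_conn hn L hU hconn IH
      · exact sound_sec hn L hU hconn IH

end WCan

end Summit.PneNP.PneNP.Theorems

end
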